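import Literature.Geometry.Lorentzian.CauchyDevelopmentPieceDomain
import Literature.Geometry.Lorentzian.CauchyHypersurfaceCausal
import HarnessLib

/-!
# Cauchy developments are causal (O'Neill 1983, Ch. 14, Cor. 14.39)

For a Cauchy development `𝒟 = (M, g, τ, ι, ν)` of initial data on a connected `n`-manifold `X`
(`CauchyDevelopment.lean`: `ι(X)` is a Cauchy hypersurface of the spacetime `(M, g, τ)`), we record
the two clauses of *causality*:

* `CauchyDevelopment.isChronological` — no closed timelike curves
  (`IsCauchyHypersurface.isChronological`, `CauchyHypersurfaceChronology.lean`);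
* `CauchyDevelopment.isCausallyWellBehaved` — no closed causal curves
  (`IsCauchyHypersurface.isCausallyWellBehaved_of_spacelike`, `CauchyHypersurfaceCausal.lean`, the
  Cauchy hypersurface `ι(X)` being spacelike: `DataEmbedding.eventually_abs_val_normal_le`).

`isCausallyWellBehaved` is the first clause of the tree's `IsGloballyHyperbolic` (Bernal–Sánchez:
causal + compact causal diamonds); the second clause (Geroch 1970; O'Neill 1983, Thm. 14.38) is
not addressed here. O'Neill 1983, Ch. 14, Lemma 14.37 and Cor. 14.39; Hawking–Ellis 1973, §6.6,
Prop. 6.6.3.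

Everything is proved; no definitions, no named facts (D-0026).

## References

* B. O'Neill, *Semi-Riemannian geometry with applications to relativity*, Academic Press 1983,
  Ch. 14, Lemma 14.37, Cor. 14.39 (pp. 422–423). [ONeillSemiRiemannian1983]
* S. W. Hawking, G. F. R. Ellis, *The large scale structure of space-time*, CUP 1973, §6.6,
  Prop. 6.6.3. [HawkingEllis1973CUP]
-/

noncomputable section

open Bundle Set Filter Function Topology TopologicalSpace
open scoped Manifold ContDiff Topology

namespace Literature.Geometry.Lorentzian

universe u

variable {n : ℕ} {X : Type u} [TopologicalSpace X] [ChartedSpace (EuclideanSpace ℝ (Fin n)) X]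
  [IsManifold (𝓡 n) ∞ X] [ConnectedSpace X] {D : InitialDataSet (𝓡 n) X}

namespace CauchyDevelopment

/-- **A Cauchy development contains no closed timelike curve.** O'Neill 1983, Ch. 14, Cor. 14.39.
[cite: ONeillSemiRiemannian1983, Ch. 14, Cor. 14.39 (p. 423)] -/
theorem isChronological (𝒟 : CauchyDevelopment D) :
    𝒟.metric.IsChronological 𝒟.timeOrientation :=
  𝒟.isCauchyHypersurface.isChronological

/-- **A Cauchy development contains no closed causal curve** (`IsCausallyWellBehaved`, the first
clause of `IsGloballyHyperbolic`): its Cauchy hypersurface `ι(X)` is spacelike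
(`DataEmbedding.eventually_abs_val_normal_le`), so
`IsCauchyHypersurface.isCausallyWellBehaved_of_spacelike` applies. O'Neill 1983, Ch. 14,
Cor. 14.39; Hawking–Ellis 1973, Prop. 6.6.3. [cite: ONeillSemiRiemannian1983, Ch. 14, Cor. 14.39 (p. 423)] -/
theorem isCausallyWellBehaved (𝒟 : CauchyDevelopment D) :
    𝒟.metric.IsCausallyWellBehaved 𝒟.timeOrientation := by
  haveI : Fact ((1 : ℕ∞ω) ≤ ∞) := ⟨by exact_mod_cast le_top⟩
  haveI : 𝒟.metric.HasLeviCivita := 𝒟.metric.toPseudoRiemannianMetric.hasLeviCivita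
  haveI : CovariantDerivative.ContMDiffCovariantDerivative 𝒟.metric.leviCivita 1 :=
    ⟨𝒟.metric.toPseudoRiemannianMetric.isLocallyContMDiff_leviCivita_holds 1
      (by rw [show ((1 : ℕ∞) : ℕ∞ω) + 1 = 2 by norm_num]; exact WithTop.coe_le_coe.2 le_top)
      univ isOpen_univ⟩
  refine LorentzianMetric.IsCauchyHypersurface.isCausallyWellBehaved_of_spacelike le_rfl
    𝒟.isCauchyHypersurface fun a ha ↦ ?_
  obtain ⟨y, rfl⟩ := ha
  refine ⟨𝒟.normal y, ?_, fun κ hκ ↦ 𝒟.toDataEmbedding.eventually_abs_val_normal_le y hκ⟩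
  show 𝒟.metric.val _ (𝒟.normal y) (𝒟.normal y) < 0
  rw [𝒟.isFutureUnitNormal.1.2 y]
  norm_num

end CauchyDevelopment

end Literature.Geometry.Lorentzian

end
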